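import Summits.BirchSwinnertonDyer.BirchSwinnertonDyer.Theorems.ThetaPartnerAtTwoSignedKatoUpToAtTwoLocalTwoSignedGeneration
import Summits.BirchSwinnertonDyer.BirchSwinnertonDyer.Theorems.ThetaPartnerAtTwoSignedKatoUpToAtTwoLocalTwoModel
import Literature.NumberTheory.GaloisRepresentations.AbsGaloisRestrictCyclotomic
import HarnessLib

/-!
# Route `ThetaPartnerAtTwo` (TP2), crux K3 `SignedKatoDivisibilityUpToAtTwo` (item stmt-BirchSwinnertonDyer-20308),
# line `colemanrat` v3 — THE LOCAL THEORY AT `p = 2`, file 10: the GLOBAL cyclotomic tower `U n = Gal(ℚ̄/ℚ(ζ_{p^{n+1}}))`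
# (stabilisers in `Γ_ℚ` of primitive `p^{n+1}`-th roots of unity) — its local subgroups ARE the stabilisers
# `Stab ζ_{p^{n+1}} ≤ Gal(ℚ̄_p/ℚ_p)` (every prime), hence Kobayashi's Prop. 8.12 ii) (generation half)
# `E(ℚ₂(ζ_{2^{n+1}})) = E⁺ + E⁻` for every globally minimal `W/ℚ` with `GoodSS W 2`, `a₂(W) = 0`, in the SOURCE's setting

HONEST FRAMING (cell `bsd-wall`, lead `bsd-wall-tp2-p2x` g2): THEOREMS ONLY — no definition, no named fact, no instance, no
`sorry`; nothing about any Selmer group is asserted; closes no item; BSD is NOT proved by any of this.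

## What is proved (`z : ℕ → ℚ̄` any family with `z n` a primitive `p^{n+1}`-th root of unity; `U n := Stab_{Γ_ℚ}(z n)`)

* §1 (every prime) `stabilizer_primitiveRoot_normal`, `stabilizer_primitiveRoot_finiteIndex` (discharge the tower's instance
  binders), `stabilizer_primitiveRoot_antitone`, **`localSubgroupOfEmb_stabilizer_eq_stab`**: `(U n)_{ℚ_p} = Stab(ζ_{p^{n+1}})` for every
  `ι : ℚ̄ → ℚ̄_p` (transport along `ι`: `ι(res σ • z) = σ • ι z`, and two primitive roots of the same order have the same
  stabiliser) — the hypothesis `hU` of file 7 for Kobayashi's own tower `ℚ ⊂ ℚ(ζ_p) ⊂ ℚ(ζ_{p²}) ⊂ …`, NO parity of `p`.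
* §2 (`p = 2`) **`sup_towerSigned_eq_localFixedPointsOfEmb_two_cyclotomic`**: for `W/ℚ` globally minimal with `GoodSS W 2` and
  `a₂(W) = 0`: `E⁺(K_{n,v}) ⊔ E⁻(K_{n,v}) = E(K_{n,v})`, `K_{n,v} = ℚ₂(ζ_{2^{n+1}})`, for EVERY `n` and every `ι` — Kobayashi's
  Prop. 8.12 ii) (generation half) AT `p = 2` in the source's setting (file 7 + file 6's model + §1), the `±`-decomposition of
  the local points along `ℚ(μ_{2^∞})` that the `Δ`-descent road to `ℚ_∞` (p579683) starts from.

References: [Kobayashi2003] §2 p. 4, Prop. 8.12; [KuriharaOtsuki2006] p. 557; [NeukirchANT1999] Ch. IV §1.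
-/

set_option autoImplicit false
-- the Theorems namespace of this sub repeats the summit name by design (D-0017 nested layout)
set_option linter.dupNamespace false

noncomputable section

open scoped Classical

namespace Summit.BirchSwinnertonDyer.BirchSwinnertonDyer.Theorems

namespace SignedKatoOffTwo.LocalTwo

open Literature.NumberTheory.EllipticCurves Literature.NumberTheory.GaloisRepresentations
  Literature.NumberTheory.EllipticCurves.FormalGroupChart WeierstrassCurve Field
open Summit.BirchSwinnertonDyer.Rank1Residual.Additive
open Summit.BirchSwinnertonDyer.Rank1Residual.Additive.PadicCyclotomicTower
open Literature.NumberTheory.EllipticCurves.Rank1Residual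

/-! ## §1 The stabiliser tower and its local subgroups, every prime -/

section Tower

variable (p : ℕ) [hp : Fact p.Prime]

/-- The stabiliser in `Γ_ℚ` of a primitive root of unity is a NORMAL subgroup (`Gal(ℚ̄/ℚ(ζ))`, `ℚ(ζ)/ℚ` Galois: a conjugate
`g⁻¹ z` is again a primitive root of the same order, with the same stabiliser). [cite: NeukirchANT1999, Ch. IV §1] -/
theorem stabilizer_primitiveRoot_normal {k : ℕ} [NeZero k] {ζ : AlgebraicClosure ℚ} (hζ : IsPrimitiveRoot ζ k) :
    (MulAction.stabilizer (absoluteGaloisGroup ℚ) ζ).Normal := by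
  refine ⟨fun h hh g => ?_⟩
  rw [MulAction.mem_stabilizer_iff] at hh ⊢
  have hζ' : IsPrimitiveRoot (g⁻¹ • ζ) k := by
    rw [absoluteGaloisGroup.smul_def]
    exact hζ.map_of_injective (AlgEquiv.injective _)
  have hfix : h • (g⁻¹ • ζ) = g⁻¹ • ζ := (smul_eq_self_iff_of_isPrimitiveRoot hζ hζ' h).mp hh
  rw [mul_smul, mul_smul, hfix, smul_inv_smul]

/-- The stabiliser in `Γ_ℚ` of a primitive root of unity has FINITE INDEX (its orbit consists of roots of `X^k − 1`).
[cite: NeukirchANT1999, Ch. IV §1] -/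
theorem stabilizer_primitiveRoot_finiteIndex {k : ℕ} [NeZero k] {ζ : AlgebraicClosure ℚ} (hζ : IsPrimitiveRoot ζ k) :
    (MulAction.stabilizer (absoluteGaloisGroup ℚ) ζ).FiniteIndex := by
  refine ⟨fun h0 => ?_⟩
  rw [MulAction.index_stabilizer] at h0
  have hsub : MulAction.orbit (absoluteGaloisGroup ℚ) ζ ⊆ ((Polynomial.nthRoots k (1 : AlgebraicClosure ℚ)).toFinset : Set _) := by
    rintro _ ⟨g, rfl⟩
    rw [Finset.mem_coe, Multiset.mem_toFinset, Polynomial.mem_nthRoots (NeZero.pos k)]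
    change (g • ζ) ^ k = 1
    rw [← smul_pow', hζ.pow_eq_one, smul_one]
  have hfin : (MulAction.orbit (absoluteGaloisGroup ℚ) ζ).Finite := (Finset.finite_toSet _).subset hsub
  rw [Set.ncard_eq_zero hfin] at h0
  exact (Set.nonempty_of_mem (MulAction.mem_orbit_self ζ)).ne_empty h0

/-- The stabiliser tower of a family of primitive `p^{n+1}`-th roots is ANTITONE (`(z (n+1))^p` is a primitive `p^{n+1}`-th root,
whose stabiliser is that of `z n`). [folklore] -/
theorem stabilizer_primitiveRoot_antitone {z : ℕ → AlgebraicClosure ℚ} (hz : ∀ n, IsPrimitiveRoot (z n) (p ^ (n + 1))) :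
    Antitone fun n => MulAction.stabilizer (absoluteGaloisGroup ℚ) (z n) := by
  refine antitone_nat_of_succ_le fun n g hg => ?_
  rw [MulAction.mem_stabilizer_iff] at hg ⊢
  haveI : NeZero (p ^ (n + 1)) := ⟨pow_ne_zero _ hp.out.ne_zero⟩
  have hpow : IsPrimitiveRoot (z (n + 1) ^ p) (p ^ (n + 1)) := by
    have h := (hz (n + 1)).pow_of_dvd hp.out.ne_zero (dvd_pow_self p (by omega : n + 1 + 1 ≠ 0))
    rwa [pow_succ, Nat.mul_div_cancel _ hp.out.pos] at h
  refine (smul_eq_self_iff_of_isPrimitiveRoot (hz n) hpow g).mpr ?_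
  rw [smul_pow', hg]

variable (ι : AlgebraicClosure ℚ →ₐ[ℚ] AlgebraicClosure ℚ_[p])

/-- **The local subgroup of `Stab_{Γ_ℚ}(ζ)` at `ι : ℚ̄ → ℚ̄_p` IS `Stab_{Γ_{ℚ_p}}(ζ_{p^{n+1}})`** for a primitive `p^{n+1}`-th root
`ζ ∈ ℚ̄` — every prime: `res_ι(τ) • ζ = ζ ↔ τ • ι ζ = ι ζ` (`ι` equivariant and injective), and `ι ζ`, `zeta p (n+1)` are primitive
roots of the same order in `ℚ̄_p`. This is the hypothesis `hU` of file 7 (`K_{n,v} = ℚ_p(ζ_{p^{n+1}})`) for Kobayashi's own tower.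
[cite: Kobayashi2003, §2 p. 4] -/
theorem localSubgroupOfEmb_stabilizer_eq_stab {n : ℕ} {ζ : AlgebraicClosure ℚ} (hζ : IsPrimitiveRoot ζ (p ^ (n + 1))) :
    localSubgroupOfEmb (MulAction.stabilizer (absoluteGaloisGroup ℚ) ζ) ι = stab p (n + 1) := by
  haveI : NeZero (p ^ (n + 1)) := ⟨pow_ne_zero _ hp.out.ne_zero⟩
  have hιζ : IsPrimitiveRoot (ι ζ) (p ^ (n + 1)) := hζ.map_of_injective ι.injective
  ext τ
  rw [mem_localSubgroupOfEmb_iff, MulAction.mem_stabilizer_iff, mem_stab_iff,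
    smul_eq_self_iff_of_isPrimitiveRoot (isPrimitiveRoot_zeta p (n + 1)) hιζ]
  rw [absoluteGaloisGroup.smul_def, absoluteGaloisGroup.smul_def]
  have h : ι ((absoluteGaloisGroup.toAlgEquiv ℚ (resGalOfEmb ι τ)) ζ) =
      (absoluteGaloisGroup.toAlgEquiv ℚ_[p] τ) (ι ζ) := apply_resGalAuxOfEmb_apply ι τ ζ
  constructor
  · intro hfix
    rw [← h, hfix]
  · intro hfix
    exact ι.injective (h.trans hfix)

end Tower

/-! ## §2 Kobayashi's Prop. 8.12 ii) at `p = 2` along `ℚ(μ_{2^∞})`, in the source's setting -/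

section Two

/-- **`E(ℚ₂(ζ_{2^{n+1}})) = E⁺ + E⁻` for every globally minimal `W/ℚ` with `GoodSS W 2` and `a₂(W) = 0`** (Kobayashi Prop. 8.12
ii), generation half, AT `p = 2`, source's setting): along the tower `U n = Stab_{Γ_ℚ}(z n)` of any family of primitive
`2^{n+1}`-th roots `z n ∈ ℚ̄` (`= Gal(ℚ̄/ℚ(ζ_{2^{n+1}}))`), at every embedding `ι : ℚ̄ → ℚ̄₂`, the local points over the `n`-th layer
are the sum of Kobayashi's signed subgroups — file 7 on the model `M_W` of file 6 with `hU` from §1. The instance binders (finite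
index, normality of the `U n`) are discharged by `stabilizer_primitiveRoot_finiteIndex` / `…_normal`.
[cite: Kobayashi2003, Prop. 8.12] [cite: KuriharaOtsuki2006, p. 557] -/
theorem sup_towerSigned_eq_localFixedPointsOfEmb_two_cyclotomic (W : WeierstrassCurve ℚ) [W.IsElliptic]
    [W.IsGloballyMinimal] (hss : GoodSS W 2) (ha : W.frobeniusTrace 2 = 0)
    (ι : AlgebraicClosure ℚ →ₐ[ℚ] AlgebraicClosure ℚ_[2]) {z : ℕ → AlgebraicClosure ℚ}
    (hz : ∀ n, IsPrimitiveRoot (z n) (2 ^ (n + 1)))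
    [hUf : ∀ n, (MulAction.stabilizer (absoluteGaloisGroup ℚ) (z n)).FiniteIndex]
    [hUN : ∀ n, (MulAction.stabilizer (absoluteGaloisGroup ℚ) (z n)).Normal] (n : ℕ) :
    towerSignedLocalPointsOfEmb (fun k => MulAction.stabilizer (absoluteGaloisGroup ℚ) (z k)) ι W 1 n ⊔
        towerSignedLocalPointsOfEmb (fun k => MulAction.stabilizer (absoluteGaloisGroup ℚ) (z k)) ι W (-1) n =
      localFixedPointsOfEmb ι W (MulAction.stabilizer (absoluteGaloisGroup ℚ) (z n)) := by
  haveI := isElliptic_coe_twoAdicModel W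
  haveI := isElliptic_toZMod_twoAdicModel W hss.1
  have htr : Literature.NumberTheory.EllipticCurves.HasseManin.tr
      (((integralModelInt W).map (Int.castRingHom ℤ_[2])).map PadicInt.toZMod) = 0 := by
    rw [tr_twoAdicModel W hss.1, ha]
  exact sup_towerSigned_eq_localFixedPointsOfEmb_two_of_stab (U := fun k => MulAction.stabilizer (absoluteGaloisGroup ℚ) (z k))
    (a₁_twoAdicModel_mem W hss) htr (stabilizer_primitiveRoot_antitone 2 hz)
    (fun k => localSubgroupOfEmb_stabilizer_eq_stab 2 ι (hz k)) (baseChange_twoAdicModel W) n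

end Two

end SignedKatoOffTwo.LocalTwo

end Summit.BirchSwinnertonDyer.BirchSwinnertonDyer.Theorems

end
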